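import Summits.ValiantsHypothesis.ValiantsHypothesis.Theorems.BarrierLeverPartitionMinorsHitByVPCubeBall

/-!
# Route BarrierLever — item `PartitionMinorsHitByVP` (stmt-ValiantsHypothesis-19717):
# the row/column SWAP for `SmallCircuits` witnesses, and ball-versus-cube

Helper file (`--supports stmt-ValiantsHypothesis-19717`; cell valiant-natproofs, rung V4, 𝒟-side door (c);
prover seat val-np-p1 gen 14). Definition-free. Closes NO item.

* `smallCircuits_hit_swap` — if some `f ∈ SmallCircuits ℂ (h+h) b` makes the layout matrix of `(u, w)` nonsingular, then
  some `f' ∈ SmallCircuits ℂ (h+h) b` (the variable flip `x_a ↔ y_a` of `f`: same size, same degree, transposed partition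
  matrix) does so for the swapped layout `(w, u)`. (The Chow-witness version is `ChowFactor.chow_hit_swap`; this is the
  class-level statement item 19717 needs.)
* `ballCube_hit` — corollary of `CubeBall.cubeBall_hit`: HAMMING BALL versus CUBE (rows ⊇ all `≤ k`-subsets of the `2k+1`
  `x`-vertices, columns = subsets of the first `2k` `y`-vertices) is hit at every `k ≥ 1`.

WHAT THIS IS NOT: a symmetry; nothing new about item 19717 beyond transporting witnesses; nothing on crux
stmt-ValiantsHypothesis-14610 or `VP` versus `VNP`.
-/

set_option linter.dupNamespace false

namespace Summit.ValiantsHypothesis.ValiantsHypothesis.Theorems.BarrierLever.LayoutSwap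

open Finset MvPolynomial
open Literature.Barriers.ValiantsHypothesis Literature.Computability.AlgebraicComplexity

noncomputable section

variable {h : ℕ}

/-- The variable flip `x_a ↔ y_a`. -/
def flipVars (h : ℕ) : Fin (h + h) ≃ Fin (h + h) :=
  finSumFinEquiv.symm.trans ((Equiv.sumComm (Fin h) (Fin h)).trans finSumFinEquiv)

/-- The flip on an `x`-variable. -/
theorem flipVars_castAdd (a : Fin h) : flipVars h (Fin.castAdd h a) = Fin.natAdd h a := by
  simp only [flipVars, Equiv.trans_apply, finSumFinEquiv_symm_apply_castAdd, Equiv.sumComm_apply,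
    Sum.swap_inl, finSumFinEquiv_apply_right]

/-- The flip on a `y`-variable. -/
theorem flipVars_natAdd (c : Fin h) : flipVars h (Fin.natAdd h c) = Fin.castAdd h c := by
  simp only [flipVars, Equiv.trans_apply, finSumFinEquiv_symm_apply_natAdd, Equiv.sumComm_apply,
    Sum.swap_inr, finSumFinEquiv_apply_left]

/-- The flip exchanges the two halves of a partition exponent. -/
theorem mapDomain_flipVars (u w : Finset (Fin h)) :
    Finsupp.mapDomain (flipVars h)
      (∑ b ∈ w, Finsupp.single (Fin.castAdd h b) 1 + ∑ d ∈ u, Finsupp.single (Fin.natAdd h d) 1 :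
        Fin (h + h) →₀ ℕ) =
      ∑ b ∈ u, Finsupp.single (Fin.castAdd h b) 1 + ∑ d ∈ w, Finsupp.single (Fin.natAdd h d) 1 := by
  have hc : ∀ A B : Fin (h + h) →₀ ℕ, A + B = B + A := fun A B => add_comm A B
  rw [Finsupp.mapDomain_add, Finsupp.mapDomain_finsetSum, Finsupp.mapDomain_finsetSum, hc]
  congr 1
  · refine Finset.sum_congr rfl fun d _ => ?_
    rw [Finsupp.mapDomain_single, flipVars_natAdd]
  · refine Finset.sum_congr rfl fun b _ => ?_
    rw [Finsupp.mapDomain_single, flipVars_castAdd]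

/-- **Row/column swap for `SmallCircuits` witnesses.** If the layout `(u, w)` is hit inside `SmallCircuits ℂ (h+h) b`, so is
the swapped layout `(w, u)` (transpose the partition matrix by flipping `x ↔ y`). -/
theorem smallCircuits_hit_swap {r b : ℕ} (u w : Fin r → Finset (Fin h))
    (hhit : ∃ f ∈ SmallCircuits ℂ (h + h) b,
      (Matrix.of fun i j : Fin r => MvPolynomial.coeff
        (∑ a ∈ u i, Finsupp.single (Fin.castAdd h a) 1 +
          ∑ c ∈ w j, Finsupp.single (Fin.natAdd h c) 1) f).det ≠ 0) :
    ∃ f ∈ SmallCircuits ℂ (h + h) b,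
      (Matrix.of fun i j : Fin r => MvPolynomial.coeff
        (∑ a ∈ w i, Finsupp.single (Fin.castAdd h a) 1 +
          ∑ c ∈ u j, Finsupp.single (Fin.natAdd h c) 1) f).det ≠ 0 := by
  obtain ⟨f, ⟨hdeg, hsize⟩, hdet⟩ := hhit
  refine ⟨rename (flipVars h) f, ⟨(totalDegree_rename_le _ _).trans hdeg, ?_⟩, ?_⟩
  · rw [show rename (flipVars h) f = renameEquiv ℂ (flipVars h) f from rfl, complexity_renameEquiv_holds]
    exact hsize
  · have hmat : (Matrix.of fun i j : Fin r => MvPolynomial.coeff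
        (∑ a ∈ w i, Finsupp.single (Fin.castAdd h a) 1 +
          ∑ c ∈ u j, Finsupp.single (Fin.natAdd h c) 1) (rename (flipVars h) f)) =
        (Matrix.of fun i j : Fin r => MvPolynomial.coeff
          (∑ a ∈ u i, Finsupp.single (Fin.castAdd h a) 1 +
            ∑ c ∈ w j, Finsupp.single (Fin.natAdd h c) 1) f).transpose := by
      ext i j
      rw [Matrix.of_apply, Matrix.transpose_apply, Matrix.of_apply, ← mapDomain_flipVars (w i) (u j),
        coeff_rename_mapDomain _ (flipVars h).injective]
    rw [hmat, Matrix.det_transpose]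
    exact hdet

/-- **HAMMING BALL versus CUBE at every height** (`h = 2k+1`, `k ≥ 1`): rows `u` containing every subset of size `≤ k` of the
`x`-vertices, columns `w` ranging injectively over subsets of the first `2k` `y`-vertices — the transpose of
`CubeBall.cubeBall_hit`. -/
theorem ballCube_hit (k : ℕ) (hk : 1 ≤ k) {r : ℕ} (u w : Fin r → Finset (Fin (2 * k + 1)))
    (hw : Function.Injective w) (hwr : ∀ j, CubeBall.vtx k (2 * k) ∉ w j)
    (hur : ∀ S : Finset (Fin (2 * k + 1)), S.card ≤ k → S ∈ Set.range u) :
    ∃ f ∈ SmallCircuits ℂ ((2 * k + 1) + (2 * k + 1)) 8,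
      (Matrix.of fun i j : Fin r => MvPolynomial.coeff
        (∑ a ∈ u i, Finsupp.single (Fin.castAdd (2 * k + 1) a) 1 +
          ∑ c ∈ w j, Finsupp.single (Fin.natAdd (2 * k + 1) c) 1) f).det ≠ 0 :=
  smallCircuits_hit_swap w u (CubeBall.cubeBall_hit k hk w u hw hwr hur)

end

end Summit.ValiantsHypothesis.ValiantsHypothesis.Theorems.BarrierLever.LayoutSwap
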